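import Summits.MatrixMultiplication.MatrixMultiplication.Theorems.GradedDesignFamily.Negative.SubfieldCellBGT
import Summits.MatrixMultiplication.MatrixMultiplication.Theorems.GradedDesignFamily.Negative.SubfieldCellFrobenius
import Summits.MatrixMultiplication.MatrixMultiplication.Theorems.GradedDesignFamily.Negative.SubfieldCellStructureTriple

/-!
# Subfield cell — CAPSTONE modulo the elementary triple-product bound (KL-P): `(KL-P) → ¬S3`

Unit `b2b-lgcu-subfield` (gen 20), supporting `stmt-MatrixMultiplication-7610` (SUBFIELD.md §25).

`not_subfieldCell_of_tripleProduct`: the design stub S3 (`stub_subfieldCell`, verbatim) is FALSE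
conditionally on ONE elementary counting statement about the subfield copy
`S₀ = SL₂(ι k) ≤ SL₂(K)` (`|K| = |k|²`), the triple-product bound
  (KL-P)  `|P|·(|P| − C₁ q²)·|P| ≤ C₂ q³ · |ι(P) b ι(P) b' ι(P)|`  for `P ⊆ SL₂(k)`, `b, b' ∉ N(S₀)`,
instead of the Breuillard–Green–Tao product theorem used by `not_subfieldCell_of_BGT2011`.
Composition: (F0) `subfieldCell_normalizer_card_le` + (P1) + (S″) `structureSliced_of_tripleProduct`
+ (P4) + (T) + sliced endgame + footprint.  (KL-P) itself follows from the fibre counts (F1)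
(`subfieldCell_twistedCentralizer_card_le`), (F2), (F2N) — see the plan `BGTFreePlan.lean`
(evidence on the crux item); (F2), (F2N) and the fibre summation are NOT yet in the tree.

HONEST FRAMING: a NEGATIVE decision of a design stub modulo an elementary, numerically verified
(q ≤ 27) counting inequality; NOT summit progress.  Sorry-free. [folklore]
-/

set_option linter.dupNamespace false

open scoped Pointwise

namespace Summit.MatrixMultiplication.MatrixMultiplication.Theorems.GradedDesignFamily.Negative

/-- **`(KL-P) → ¬S3`** (S3 verbatim).  NOT summit progress. [folklore] -/
theorem not_subfieldCell_of_tripleProduct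
    (hTP : ∃ C₁ C₂ : ℝ, 0 < C₂ ∧ ∃ q₀ : ℕ,
      ∀ (k K : Type) [Field k] [Fintype k] [DecidableEq k] [Field K] [Fintype K] [DecidableEq K]
        (ι : k →+* K), Fintype.card K = Fintype.card k ^ 2 → q₀ ≤ Fintype.card k →
        ∀ (P : Finset (Matrix.SpecialLinearGroup (Fin 2) k))
          (b b' : Matrix.SpecialLinearGroup (Fin 2) K),
          b ∉ Subgroup.normalizer (((Matrix.SpecialLinearGroup.map ι :
              Matrix.SpecialLinearGroup (Fin 2) k →* Matrix.SpecialLinearGroup (Fin 2) K).range :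
              Subgroup (Matrix.SpecialLinearGroup (Fin 2) K)) :
              Set (Matrix.SpecialLinearGroup (Fin 2) K)) →
          b' ∉ Subgroup.normalizer (((Matrix.SpecialLinearGroup.map ι :
              Matrix.SpecialLinearGroup (Fin 2) k →* Matrix.SpecialLinearGroup (Fin 2) K).range :
              Subgroup (Matrix.SpecialLinearGroup (Fin 2) K)) :
              Set (Matrix.SpecialLinearGroup (Fin 2) K)) →
          (P.card : ℝ) * ((P.card : ℝ) - C₁ * (Fintype.card k : ℝ) ^ 2) * P.card ≤
            C₂ * (Fintype.card k : ℝ) ^ 3 *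
              ((P.image (Matrix.SpecialLinearGroup.map ι) * {b} *
                P.image (Matrix.SpecialLinearGroup.map ι) * {b'} *
                P.image (Matrix.SpecialLinearGroup.map ι)).card : ℝ)) :
    ¬ (∃ c : ℝ, 0 < c ∧ ∀ N : ℕ, ∃ (k K : Type) (_ : Field k) (_ : Fintype k) (_ : DecidableEq k)
      (_ : Field K) (_ : Fintype K) (_ : DecidableEq K)
      (φ : Matrix.SpecialLinearGroup (Fin 2) k →* Matrix.GeneralLinearGroup (Fin 2) K),
      Function.Injective φ ∧ Fintype.card K = Fintype.card k ^ 2 ∧ N ≤ Fintype.card K ∧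
      ∃ Y Z : Finset (Matrix.GeneralLinearGroup (Fin 2) K),
        c * (Fintype.card K : ℝ) ^ (3 / 2 : ℝ) ≤ (Finset.univ.image φ).card ∧
        c * (Fintype.card K : ℝ) ^ (3 / 2 : ℝ) ≤ Y.card ∧
        c * (Fintype.card K : ℝ) ^ (3 / 2 : ℝ) ≤ Z.card ∧
        ∀ z₀ ∈ Z, ∃ cf : (Fin 2 → K) → (Fin 2 → K) → ℂ,
          ∀ a : Matrix.SpecialLinearGroup (Fin 2) k, ∀ y ∈ Y, ∀ y' ∈ Y, ∀ z ∈ Z,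
            (∑ u : Fin 2 → K, cf u (((φ a * y * y'⁻¹ * z : Matrix.GeneralLinearGroup (Fin 2) K) :
                Matrix (Fin 2) (Fin 2) K).mulVec u)) =
              if a = 1 ∧ y = y' ∧ z = z₀ then 1 else 0) :=
  not_subfieldCell_of_footprintExpansion
    (footprintExpansion_of_sliced taoProductSet
      (structureSliced_of_tripleProduct subfieldCell_normalizer_card_le subfieldCell_detPigeonhole
        hTP subfieldCell_slicedCounting)
      subfieldCell_slicedEndgame)

end Summit.MatrixMultiplication.MatrixMultiplication.Theorems.GradedDesignFamily.Negative
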